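import Literature.AlgebraicGeometry.ModuliOfAbelianVarieties.SiegelHeckeLinkMultiplier
import HarnessLib

/-!
# The INTEGRAL Hecke datum `(γ, γ⋆)` of a `QuotientAdapted` link of degree `d` at principal representatives

Cell hodgecm-mathlib (D-0151), Hecke-link socket (B), (O-y) glue brick (B-p21 (g14) 23:51:25Z).  THEOREMS ONLY; no
definition, no named fact, no instance.

At principal representatives `r, r′ ∈ K_δ(1)` the lattices are `Λ_r = Λ_{r′} = ℤ^{2g}`, so a link datum `γ` with
`QuotientAdapted δ δ N N′ r r′ γ`, `N′ = N·d`, and similitude factor `d` (`ᵗγ E_δ γ = d·E_δ`) is an INTEGRAL matrix `γm`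
(★ `QuotientAdapted.forall_exists_int_eq`) with an integral «adjoint» `γ⋆ := d·γ⁻¹` ((QA2): `N′·γ⁻¹ℤ^{2g} ⊆ N·ℤ^{2g}`):

* `QuotientAdapted.exists_intDatum` — **`∃ γs, γm γs = d·1 ∧ γs γm = d·1 ∧ ᵗγs E_δ γs = d·E_δ ∧ N ∣ (γm − 1)`**, i.e.
  exactly the binders `(γm γs hγ hγ′ hsim hQA4)` of ★ `exists_level_symplectic_of_heckeQuotient` /
  ★ `coprime_of_heckeDatum` (`ᵗγs E γs = d E` without inverses: `ᵗγs (ᵗγ E γ) γs = ᵗ(γγs) E (γγs) = d²E` and `= d·ᵗγs E γs`;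
  (QA4) `(γ − 1)ℤ^{2g} ⊆ N·ℤ^{2g}` read on the standard basis);
* `smul_eq_zero_of_kernelIndex` — **`(γ̄m R) c = 0 ⇒ d • c = 0`** in `(ℤ/M)^{2g}` for any `R ∈ GL_{2g}(ℤ/M)` (multiply by
  `γ̄s`, cancel the unit `R`): the Hecke kernel `K₀ = ker(γ̄m·R)` lies in the `d`-torsion.

## References

* [ShimuraIATAF1971] G. Shimura, *Introduction to the Arithmetic Theory of Automorphic Functions* (1971), §3.2.
* [Milne2005ShimuraVarieties] J. S. Milne, *Introduction to Shimura Varieties* (2005), §4 pp. 48–49; §6 Thm. 6.11 pp. 74–75.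
* [Deligne1971TravauxShimura] P. Deligne, *Travaux de Shimura*, Sém. Bourbaki 389 (1971), 4.11–4.12 pp. 148–149.
-/

open Matrix
open Literature.NumberTheory.Adeles (latticeOfGL mem_latticeOfGL_one_iff)

namespace Literature.AlgebraicGeometry.ModuliOfAbelianVarieties

variable {g : ℕ}

/-- Casting `d • 1` from `ℤ` to `ℚ` entrywise. [folklore] -/
private theorem map_natCast_smul_one {n : Type*} [DecidableEq n] (d : ℕ) :
    ((d : ℤ) • (1 : Matrix n n ℤ)).map (Int.castRingHom ℚ) = (d : ℚ) • (1 : Matrix n n ℚ) := by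
  ext i j
  rw [Matrix.map_apply, Matrix.smul_apply, Matrix.smul_apply, smul_eq_mul, smul_eq_mul, eq_intCast, Int.cast_mul,
    Int.cast_natCast, Matrix.one_apply, Matrix.one_apply]
  split_ifs <;> simp

/-- Casting `d • E_δ` from `ℤ` to `ℚ` entrywise. [folklore] -/
private theorem map_natCast_smul_typeForm (δ : Fin g → ℕ) (d : ℕ) :
    ((d : ℤ) • typeForm δ).map (Int.castRingHom ℚ) = (d : ℚ) • typeFormOver δ ℚ := by
  ext i j
  rw [Matrix.map_apply, Matrix.smul_apply, Matrix.smul_apply, smul_eq_mul, smul_eq_mul, eq_intCast, Int.cast_mul,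
    Int.cast_natCast, typeFormOver_apply]

variable {N N' d : ℕ} {δ : Fin g → ℕ} {r r' : gspFinAdelic δ} {γq : GL (Fin g ⊕ Fin g) ℚ}

/-- **The integral Hecke datum of a degree-`d` link at principal representatives.**  For `QuotientAdapted δ δ N N′ r r′ γ`
with `r ∈ K_δ(1)`, `N ≠ 0`, `N′ = N·d`, `d ≠ 0`, similitude factor `d` and `γ = γm` integral: there is an integral `γs` with
`γm γs = d·1 = γs γm`, `ᵗγs E_δ γs = d·E_δ`, and `N ∣ (γm − 1)` entrywise.
[cite: ShimuraIATAF1971, §3.2 («det β = b»)] [cite: Milne2005ShimuraVarieties, §4 pp. 48–49 and §6 Thm. 6.11 pp. 74–75]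
[cite: Deligne1971TravauxShimura, 4.11–4.12 pp. 148–149] -/
theorem QuotientAdapted.exists_intDatum (h : QuotientAdapted δ δ N N' r r' γq)
    (hr : r ∈ principalLevelSubgroup δ 1) (hN : N ≠ 0) (hd : N' = N * d) (hd0 : d ≠ 0)
    (hsim : (γq : Matrix (Fin g ⊕ Fin g) (Fin g ⊕ Fin g) ℚ)ᵀ * typeFormOver δ ℚ *
      (γq : Matrix (Fin g ⊕ Fin g) (Fin g ⊕ Fin g) ℚ) = (d : ℚ) • typeFormOver δ ℚ)
    (γm : Matrix (Fin g ⊕ Fin g) (Fin g ⊕ Fin g) ℤ)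
    (hγ : (γq : Matrix (Fin g ⊕ Fin g) (Fin g ⊕ Fin g) ℚ) = γm.map (Int.cast : ℤ → ℚ)) :
    ∃ γs : Matrix (Fin g ⊕ Fin g) (Fin g ⊕ Fin g) ℤ,
      γm * γs = (d : ℤ) • (1 : Matrix (Fin g ⊕ Fin g) (Fin g ⊕ Fin g) ℤ) ∧
      γs * γm = (d : ℤ) • (1 : Matrix (Fin g ⊕ Fin g) (Fin g ⊕ Fin g) ℤ) ∧
      γsᵀ * typeForm δ * γs = (d : ℤ) • typeForm δ ∧
      ∀ k i, (N : ℤ) ∣ (γm - 1) k i := by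
  -- lattices at principal representatives are `ℤ^{2g}`
  have hr' := h.mem_principalLevelSubgroup_one hr
  obtain ⟨-, -, -, hQA2, hQA4, -⟩ := h
  have hΛr := latticeOfGL_coe_eq_one_of_mem_principalLevelSubgroup_one hr
  have hΛr' := latticeOfGL_coe_eq_one_of_mem_principalLevelSubgroup_one hr'
  have hγ' : (γq : Matrix (Fin g ⊕ Fin g) (Fin g ⊕ Fin g) ℚ) = γm.map (Int.castRingHom ℚ) := hγ
  have hinj : Function.Injective fun M : Matrix (Fin g ⊕ Fin g) (Fin g ⊕ Fin g) ℤ => M.map (Int.castRingHom ℚ) :=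
    Matrix.map_injective (Int.castRingHom ℚ).injective_int
  -- `S := d • γ⁻¹`
  set S : Matrix (Fin g ⊕ Fin g) (Fin g ⊕ Fin g) ℚ :=
    (d : ℚ) • ((γq⁻¹ : GL (Fin g ⊕ Fin g) ℚ) : Matrix (Fin g ⊕ Fin g) (Fin g ⊕ Fin g) ℚ) with hS
  clear_value S
  have hqS : (γq : Matrix (Fin g ⊕ Fin g) (Fin g ⊕ Fin g) ℚ) * S = (d : ℚ) • 1 := by
    rw [hS, Matrix.mul_smul, Units.mul_inv]
  have hSq : S * (γq : Matrix (Fin g ⊕ Fin g) (Fin g ⊕ Fin g) ℚ) = (d : ℚ) • 1 := by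
    rw [hS, Matrix.smul_mul, Units.inv_mul]
  -- (QA2): `S` is integral
  have hSint : ∀ i j, ∃ z : ℤ, (z : ℚ) = S i j := by
    refine forall_exists_int_eq_of_forall_mulVec fun w hw => ?_
    obtain ⟨v, hv, hvw⟩ := hQA2 w (by rw [hΛr, mem_latticeOfGL_one_iff]; exact hw)
    rw [hΛr', mem_latticeOfGL_one_iff] at hv
    have hN0 : (N : ℚ) ≠ 0 := by exact_mod_cast hN
    have hSv : S *ᵥ w = v := by
      apply smul_right_injective (Fin g ⊕ Fin g → ℚ) hN0
      change (N : ℚ) • (S *ᵥ w) = (N : ℚ) • v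
      rw [hS, Matrix.smul_mulVec, smul_smul, ← hvw, hd, Nat.cast_mul]
    intro i
    rw [hSv]
    exact hv i
  obtain ⟨γs, hγs⟩ := exists_intMatrix_map_eq_of_forall_exists_int_eq hSint
  -- `ᵗS E S = d E` (no inverses: `ᵗS (ᵗγ E γ) S = ᵗ(γ S) E (γ S) = d² E` and `= d ᵗS E S`)
  have hSsim : Sᵀ * typeFormOver δ ℚ * S = (d : ℚ) • typeFormOver δ ℚ := by
    have hd0' : (d : ℚ) ≠ 0 := by exact_mod_cast hd0
    apply smul_right_injective (Matrix (Fin g ⊕ Fin g) (Fin g ⊕ Fin g) ℚ) hd0'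
    change (d : ℚ) • (Sᵀ * typeFormOver δ ℚ * S) = (d : ℚ) • ((d : ℚ) • typeFormOver δ ℚ)
    calc (d : ℚ) • (Sᵀ * typeFormOver δ ℚ * S)
        = Sᵀ * ((γq : Matrix (Fin g ⊕ Fin g) (Fin g ⊕ Fin g) ℚ)ᵀ * typeFormOver δ ℚ *
            (γq : Matrix (Fin g ⊕ Fin g) (Fin g ⊕ Fin g) ℚ)) * S := by
          rw [hsim, Matrix.mul_smul, Matrix.smul_mul]
      _ = ((γq : Matrix (Fin g ⊕ Fin g) (Fin g ⊕ Fin g) ℚ) * S)ᵀ * typeFormOver δ ℚ *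
            ((γq : Matrix (Fin g ⊕ Fin g) (Fin g ⊕ Fin g) ℚ) * S) := by
          rw [Matrix.transpose_mul]; simp only [Matrix.mul_assoc]
      _ = (d : ℚ) • ((d : ℚ) • typeFormOver δ ℚ) := by
          rw [hqS, Matrix.transpose_smul, Matrix.transpose_one, Matrix.smul_mul, Matrix.one_mul, Matrix.mul_smul,
            Matrix.mul_one, smul_smul]
  refine ⟨γs, hinj ?_, hinj ?_, hinj ?_, fun k i => ?_⟩
  · change (γm * γs).map (Int.castRingHom ℚ) = ((d : ℤ) • (1 : Matrix _ _ ℤ)).map (Int.castRingHom ℚ)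
    rw [Matrix.map_mul, hγs, ← hγ', hqS, map_natCast_smul_one]
  · change (γs * γm).map (Int.castRingHom ℚ) = ((d : ℤ) • (1 : Matrix _ _ ℤ)).map (Int.castRingHom ℚ)
    rw [Matrix.map_mul, hγs, ← hγ', hSq, map_natCast_smul_one]
  · change (γsᵀ * typeForm δ * γs).map (Int.castRingHom ℚ) = ((d : ℤ) • typeForm δ).map (Int.castRingHom ℚ)
    rw [Matrix.map_mul, Matrix.map_mul, Matrix.transpose_map, hγs, map_natCast_smul_typeForm, ← hSsim]
    rfl
  · -- (QA4) on the standard basis vector `e_i`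
    have he : (Pi.single i 1 : Fin g ⊕ Fin g → ℚ) ∈ latticeOfGL ((r : gspFinAdelic δ) : GL (Fin g ⊕ Fin g) finAdeleQ) := by
      rw [hΛr, mem_latticeOfGL_one_iff]
      intro j
      by_cases hj : j = i
      · subst hj; exact ⟨1, by simp⟩
      · exact ⟨0, by simp [hj]⟩
    obtain ⟨w', hw', hw⟩ := hQA4 (Pi.single i 1) he
    rw [hΛr, mem_latticeOfGL_one_iff] at hw'
    obtain ⟨z, hz⟩ := hw' k
    refine ⟨z, Int.cast_injective (α := ℚ) ?_⟩
    have hk := congrFun hw k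
    rw [Matrix.mulVec_single_one, Pi.sub_apply, Pi.smul_apply, smul_eq_mul, ← hz, hγ'] at hk
    -- `hk : (γm.map _).col i k - Pi.single i 1 k = N * z`
    rw [Int.cast_mul, Int.cast_natCast, ← hk, Matrix.sub_apply, Int.cast_sub, Matrix.col_apply, Matrix.map_apply,
      eq_intCast, Matrix.one_apply, Pi.single_apply]
    by_cases hki : k = i
    · subst hki; simp
    · simp [hki]

/-- **The Hecke kernel lies in the `d`-torsion**: if `γs γm = d·1` over `ℤ`, then for every `R ∈ GL_{2g}(ℤ/M)` and every
`c ∈ (ℤ/M)^{2g}` with `(γ̄m R) c = 0` one has `d • c = 0` (apply `γ̄s`, cancel the unit `R`).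
[cite: ShimuraIATAF1971, §3.2] [cite: Milne2005ShimuraVarieties, §6 Thm. 6.11 pp. 74–75] -/
theorem smul_eq_zero_of_kernelIndex {M : ℕ} [NeZero M] (γm γs : Matrix (Fin g ⊕ Fin g) (Fin g ⊕ Fin g) ℤ)
    (hγ' : γs * γm = (d : ℤ) • (1 : Matrix (Fin g ⊕ Fin g) (Fin g ⊕ Fin g) ℤ)) (R : GL (Fin g ⊕ Fin g) (ZMod M))
    (c : Fin g ⊕ Fin g → ZMod M)
    (h : (γm.map (Int.castRingHom (ZMod M)) * (R : Matrix (Fin g ⊕ Fin g) (Fin g ⊕ Fin g) (ZMod M))) *ᵥ c = 0) :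
    (d : ZMod M) • c = 0 := by
  -- `γ̄s γ̄m = d • 1` over `ℤ/M`
  have hsm : γs.map (Int.castRingHom (ZMod M)) * γm.map (Int.castRingHom (ZMod M)) = (d : ZMod M) • 1 := by
    rw [← Matrix.map_mul, hγ']
    ext i j
    rw [Matrix.map_apply, Matrix.smul_apply, Matrix.smul_apply, smul_eq_mul, smul_eq_mul, eq_intCast, Int.cast_mul,
      Int.cast_natCast, Matrix.one_apply, Matrix.one_apply]
    split_ifs <;> simp
  -- apply `γ̄s`: `(d • R) c = 0`
  have h1 : ((d : ZMod M) • (R : Matrix (Fin g ⊕ Fin g) (Fin g ⊕ Fin g) (ZMod M))) *ᵥ c = 0 := by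
    have h2 := congrArg (fun v => γs.map (Int.castRingHom (ZMod M)) *ᵥ v) h
    simp only [Matrix.mulVec_mulVec, Matrix.mulVec_zero, ← Matrix.mul_assoc, hsm, Matrix.smul_mul,
      Matrix.one_mul] at h2
    exact h2
  -- cancel the unit `R`
  have h3 : (R : Matrix (Fin g ⊕ Fin g) (Fin g ⊕ Fin g) (ZMod M)) *ᵥ ((d : ZMod M) • c) = 0 := by
    rw [Matrix.mulVec_smul, ← Matrix.smul_mulVec, h1]
  have h4 := congrArg (fun v => ((R⁻¹ : GL (Fin g ⊕ Fin g) (ZMod M)) : Matrix (Fin g ⊕ Fin g) (Fin g ⊕ Fin g) (ZMod M)) *ᵥ v) h3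
  simp only [Matrix.mulVec_mulVec, Units.inv_mul, Matrix.one_mulVec, Matrix.mulVec_zero] at h4
  exact h4

end Literature.AlgebraicGeometry.ModuliOfAbelianVarieties
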